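import Mathlib.Analysis.InnerProductSpace.Adjoint
import Mathlib.Analysis.InnerProductSpace.Projection.Basic
import Mathlib.Analysis.Normed.Operator.Compact.Basic
import Literature.Analysis.OperatorTheory.TempleCertificate
import HarnessLib

/-!
# Compression of a compact self-adjoint operator to a closed invariant subspace
# (Reed–Simon I, §VI.5–6; Kato, *Perturbation theory*, §V.3.5)

Topic `Analysis/OperatorTheory`; theorems only (no definition, no named fact, no instance).

A bounded self-adjoint `A` on a Hilbert space `H` leaving a closed subspace `V` invariant (for instance
`V = ran P` for an orthogonal projection `P` commuting with `A` — a symmetry sector) has a COMPRESSION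
`T = A|_V : V → V`, again self-adjoint, and compact if `A` is.  The hypotheses of the certified eigenvalue
bounds of `TempleCertificate.lean` for `T` are produced here from data on `H`:

* `exists_compression` — `∃ T : V →L V` with `(T v : H) = A v`, self-adjoint / compact when `A` is;
* `compression_inner_norm` — `⟪v, Tv⟫ = ⟪v, Av⟫`, `‖Tv‖ = ‖Av‖`;
* `negSqMass_le_of_family_bound` — if `B ≥ 0` and `Σ_j ‖A f_j - B f_j‖² ≤ h` for every finite orthonormal
  family of `V` (a deflated Hilbert–Schmidt bound), then `Σ_j c_j² ≤ h` for every orthonormal family of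
  eigenvectors of `T` with negative eigenvalues `c_j` (the `hsq` hypothesis of `temple_certificate`);
* `doublet_of_isometry` — if an isometry `U` of `H` commuting with `A` preserves `V` and `⟪v, U v⟫ = 0` on
  `V`, every eigenvector of `T` lies in an orthonormal PAIR of eigenvectors (`hmult` with `d = 2`);
* `rayleigh_ge_neg_of_negSqMass_le` — the far-channel bound: `Σ c_j² ≤ h ≤ s²` forces `-s ‖y‖² ≤ Re⟪y, Ty⟫`;
* `norm_sub_starProjection_le_of_mem` — the orthogonal projection onto a subspace is at least as close as
  any of its elements, is a contraction, and `x - P_K x ⊥ P_K x` (upgrading Kato's enclosure).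
[folklore]

## References
* M. Reed, B. Simon, *Methods of Modern Mathematical Physics I* (1980), §VI.5–6 [ReedSimonI1980].
* T. Kato, *Perturbation Theory for Linear Operators* (1966), §V.3.5 [Kato1966].
-/

noncomputable section

open scoped InnerProductSpace ComplexConjugate
open Filter

namespace Literature.Analysis.OperatorTheory

variable {𝕜 : Type*} [RCLike 𝕜] {H : Type*} [NormedAddCommGroup H] [InnerProductSpace 𝕜 H]

/-- **Compression to a closed invariant subspace.** For a bounded `A` leaving the complete subspace `V`
invariant there is a bounded `T` on `V` with `(T v : H) = A v`; it is self-adjoint if `A` is, and compact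
if `A` is. [cite: ReedSimonI1980, Thm. VI.16] -/
theorem exists_compression [CompleteSpace H] (A : H →L[𝕜] H) (V : Submodule 𝕜 H) [CompleteSpace V]
    (hV : ∀ v ∈ V, A v ∈ V) :
    ∃ T : V →L[𝕜] V, (∀ v : V, (T v : H) = A v) ∧ (IsSelfAdjoint A → IsSelfAdjoint T) ∧
      (IsCompactOperator A → IsCompactOperator T) := by
  set T : V →L[𝕜] V := V.orthogonalProjectionOnto.comp (A.comp V.subtypeL) with hT
  have hTv : ∀ v : V, (T v : H) = A v := by
    intro v
    have hmem : A v ∈ V := hV v v.2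
    have h1 : T v = V.orthogonalProjectionOnto (A (v : H)) := rfl
    have h2 : V.orthogonalProjectionOnto (A (v : H)) = ⟨A v, hmem⟩ :=
      V.orthogonalProjectionOnto_mem_subspace_eq_self ⟨A v, hmem⟩
    rw [h1, h2]
  refine ⟨T, hTv, fun hA => ?_, fun hAc => ?_⟩
  · rw [ContinuousLinearMap.isSelfAdjoint_iff_isSymmetric]
    intro v w
    change ⟪T v, w⟫_𝕜 = ⟪v, T w⟫_𝕜
    rw [Submodule.coe_inner, Submodule.coe_inner, hTv, hTv]
    exact (ContinuousLinearMap.isSelfAdjoint_iff_isSymmetric.1 hA) v w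
  · have h1 : IsCompactOperator (A.comp V.subtypeL) := hAc.comp_clm V.subtypeL
    exact h1.clm_comp V.orthogonalProjectionOnto

omit [InnerProductSpace 𝕜 H] in
/-- Inner products and norms of the compression are those of `A`. [folklore] -/
theorem compression_inner_norm [InnerProductSpace 𝕜 H] {A : H →L[𝕜] H} {V : Submodule 𝕜 H}
    {T : V →L[𝕜] V} (hT : ∀ v : V, (T v : H) = A v) (v : V) :
    ⟪v, T v⟫_𝕜 = ⟪(v : H), A v⟫_𝕜 ∧ ‖T v‖ = ‖A v‖ := by
  refine ⟨?_, ?_⟩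
  · rw [Submodule.coe_inner, hT]
  · rw [Submodule.coe_norm, hT]

/-- **Negative square mass from a deflated Hilbert–Schmidt family bound.** If `B` is a positive form on `H`
and `Σ_j ‖A f_j - B f_j‖² ≤ h` for every finite orthonormal family `(f_j)` in `V`, then every orthonormal
family of eigenvectors of the compression `T` with negative eigenvalues `c_j` has `Σ_j c_j² ≤ h`: indeed
`Re⟪w, (A - B) w⟫ = c - Re⟪w, B w⟫ ≤ c < 0`, so `c² ≤ ‖(A - B) w‖²`. [folklore] -/
theorem negSqMass_le_of_family_bound {A B : H →L[𝕜] H} {V : Submodule 𝕜 H} {T : V →L[𝕜] V}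
    (hT : ∀ v : V, (T v : H) = A v) (hB : ∀ y : H, 0 ≤ RCLike.re ⟪y, B y⟫_𝕜) {h : ℝ}
    (hfam : ∀ (m : ℕ) (f : Fin m → H), Orthonormal 𝕜 f → (∀ j, f j ∈ V) →
      ∑ j, ‖A (f j) - B (f j)‖ ^ 2 ≤ h) :
    ∀ (m : ℕ) (w : Fin m → V) (c : Fin m → ℝ), Orthonormal 𝕜 w →
      (∀ j, c j < 0 ∧ T (w j) = (c j : 𝕜) • w j) → ∑ j, c j ^ 2 ≤ h := by
  intro m w c hw hcw
  have hfo : Orthonormal 𝕜 (fun j => (w j : H)) := by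
    rw [orthonormal_iff_ite] at hw ⊢
    intro i j
    rw [← Submodule.coe_inner, hw i j]
  have hbound := hfam m (fun j => (w j : H)) hfo (fun j => (w j).2)
  refine le_trans (Finset.sum_le_sum fun j _ => ?_) hbound
  -- `c_j² ≤ ‖A w_j - B w_j‖²`
  obtain ⟨hcj, hTj⟩ := hcw j
  have hunit : ‖(w j : H)‖ = 1 := hw.norm_eq_one j
  have hinnerA : RCLike.re ⟪(w j : H), A (w j)⟫_𝕜 = c j := by
    rw [← hT, ← Submodule.coe_inner, hTj, inner_smul_right, inner_self_eq_norm_sq_to_K, hw.norm_eq_one j]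
    simp
  have hre : RCLike.re ⟪(w j : H), A (w j) - B (w j)⟫_𝕜 ≤ c j := by
    rw [inner_sub_right, map_sub, hinnerA]
    linarith [hB (w j)]
  have hneg : RCLike.re ⟪(w j : H), A (w j) - B (w j)⟫_𝕜 < 0 := hre.trans_lt hcj
  have h1 : |RCLike.re ⟪(w j : H), A (w j) - B (w j)⟫_𝕜| ≤ ‖⟪(w j : H), A (w j) - B (w j)⟫_𝕜‖ :=
    RCLike.abs_re_le_norm _
  have h2 : ‖⟪(w j : H), A (w j) - B (w j)⟫_𝕜‖ ≤ ‖(w j : H)‖ * ‖A (w j) - B (w j)‖ := norm_inner_le_norm _ _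
  rw [hunit, one_mul] at h2
  have h3 : |c j| ≤ ‖A (w j) - B (w j)‖ := by
    have : |c j| ≤ |RCLike.re ⟪(w j : H), A (w j) - B (w j)⟫_𝕜| := by
      rw [abs_of_neg hcj, abs_of_neg hneg]; linarith
    exact this.trans (h1.trans h2)
  have h4 : |c j| ^ 2 ≤ ‖A (w j) - B (w j)‖ ^ 2 := pow_le_pow_left₀ (abs_nonneg _) h3 2
  rwa [sq_abs] at h4

/-- **Symmetry doublets.** If `U` is an isometry of `H` commuting with `A`, preserving `V`, with `⟪v, U v⟫ = 0`
for all `v ∈ V`, then every eigenvector of the compression `T` with eigenvalue `c` belongs to an orthonormal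
pair of eigenvectors for `c` (namely `v̂, U v̂`). [folklore] -/
theorem doublet_of_isometry {A U : H →L[𝕜] H} {V : Submodule 𝕜 H} {T : V →L[𝕜] V}
    (hT : ∀ v : V, (T v : H) = A v) (hAU : A * U = U * A) (hUV : ∀ v ∈ V, U v ∈ V)
    (hU : ∀ φ ψ : H, ⟪U φ, U ψ⟫_𝕜 = ⟪φ, ψ⟫_𝕜) (horth : ∀ v ∈ V, ⟪v, U v⟫_𝕜 = 0) :
    ∀ (c : ℝ) (v : V), c < 0 → v ≠ 0 → T v = (c : 𝕜) • v →
      ∃ w : Fin 2 → V, Orthonormal 𝕜 w ∧ ∀ j, T (w j) = (c : 𝕜) • w j := by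
  intro c v _hc hv hTv
  -- normalise `v`
  have hvn : ‖(v : H)‖ ≠ 0 := by
    rw [Submodule.norm_coe]; exact norm_ne_zero_iff.2 hv
  obtain ⟨v₁, hv₁n, hTv₁⟩ : ∃ v₁ : V, ‖(v₁ : H)‖ = 1 ∧ T v₁ = (c : 𝕜) • v₁ := by
    refine ⟨(((‖(v : H)‖⁻¹ : ℝ) : 𝕜)) • v, ?_, ?_⟩
    · rw [Submodule.coe_smul, norm_smul, RCLike.norm_ofReal,
        abs_of_nonneg (inv_nonneg.2 (norm_nonneg _)), inv_mul_cancel₀ hvn]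
    · rw [map_smul, hTv, smul_comm]
  -- the partner `U v₁ ∈ V`
  set v₂ : V := ⟨U v₁, hUV _ v₁.2⟩ with hv₂
  have hv₂n : ‖(v₂ : H)‖ = 1 := by
    change ‖U v₁‖ = 1
    have h1 : ‖U (v₁ : H)‖ ^ 2 = ‖(v₁ : H)‖ ^ 2 := by
      rw [@norm_sq_eq_re_inner 𝕜, @norm_sq_eq_re_inner 𝕜, hU]
    nlinarith [norm_nonneg (U (v₁ : H)), norm_nonneg (v₁ : H), hv₁n]
  have hTv₂ : T v₂ = (c : 𝕜) • v₂ := by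
    apply Subtype.ext
    rw [hT, Submodule.coe_smul]
    change A (U v₁) = (c : 𝕜) • U v₁
    have h1 : A (U (v₁ : H)) = U (A v₁) := by
      change (A * U) v₁ = (U * A) v₁
      rw [hAU]
    rw [h1, ← hT, hTv₁, Submodule.coe_smul, map_smul]
  have h12 : ⟪(v₁ : H), v₂⟫_𝕜 = 0 := horth _ v₁.2
  refine ⟨![v₁, v₂], ?_, ?_⟩
  · rw [orthonormal_iff_ite]
    intro i j
    fin_cases i <;> fin_cases j
    · simp only [Fin.zero_eta, Fin.isValue, Matrix.cons_val_zero, ↓reduceIte]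
      rw [Submodule.coe_inner, inner_self_eq_norm_sq_to_K, hv₁n]; simp
    · simp only [Fin.zero_eta, Fin.isValue, Matrix.cons_val_zero, Fin.mk_one, Matrix.cons_val_one,
        Matrix.cons_val_fin_one, zero_ne_one, ↓reduceIte]
      rw [Submodule.coe_inner, h12]
    · simp only [Fin.mk_one, Fin.isValue, Matrix.cons_val_one, Matrix.cons_val_fin_one, Fin.zero_eta,
        Matrix.cons_val_zero, one_ne_zero, ↓reduceIte]
      rw [Submodule.coe_inner, ← inner_conj_symm, h12, map_zero]
    · simp only [Fin.mk_one, Fin.isValue, Matrix.cons_val_one, Matrix.cons_val_fin_one, ↓reduceIte]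
      rw [Submodule.coe_inner, inner_self_eq_norm_sq_to_K, hv₂n]; simp
  · intro j
    fin_cases j
    · exact hTv₁
    · exact hTv₂

/-- **The far-channel bound.** For a compact self-adjoint `T` whose orthonormal eigenfamilies with negative
eigenvalues have square mass `≤ h ≤ s²` (`s ≥ 0`): `-s ‖y‖² ≤ Re⟪y, T y⟫` for every `y` (each negative eigenvalue is
`≥ -s`; expand in an eigenbasis). [folklore] -/
theorem rayleigh_ge_neg_of_negSqMass_le {E : Type*} [NormedAddCommGroup E] [InnerProductSpace 𝕜 E]
    [CompleteSpace E] {T : E →L[𝕜] E} (hT : IsCompactOperator T) (hsa : IsSelfAdjoint T) {h s : ℝ}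
    (hs : 0 ≤ s) (hhs : h ≤ s ^ 2)
    (hsq : ∀ (m : ℕ) (w : Fin m → E) (c : Fin m → ℝ), Orthonormal 𝕜 w →
      (∀ j, c j < 0 ∧ T (w j) = (c j : 𝕜) • w j) → ∑ j, c j ^ 2 ≤ h) (y : E) :
    -s * ‖y‖ ^ 2 ≤ RCLike.re ⟪y, T y⟫_𝕜 := by
  obtain ⟨t, b, κ, -, hTb⟩ := exists_hilbertBasis_eigenvectors_of_isSelfAdjoint hT hsa
  have hsym : ∀ x y : E, ⟪T x, y⟫_𝕜 = ⟪x, T y⟫_𝕜 :=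
    (ContinuousLinearMap.isSelfAdjoint_iff_isSymmetric.1 hsa)
  have hmin : ∀ i, -s ≤ κ i := by
    intro i
    by_cases hi : 0 ≤ κ i
    · linarith
    push Not at hi
    have hone : Orthonormal 𝕜 (![b i] : Fin 1 → E) := by
      rw [orthonormal_iff_ite]
      intro p q
      fin_cases p; fin_cases q
      simp only [Fin.zero_eta, Fin.isValue, Matrix.cons_val_fin_one, ↓reduceIte]
      rw [inner_self_eq_norm_sq_to_K, b.orthonormal.norm_eq_one i]; simp
    have h1 := hsq 1 ![b i] (fun _ => κ i) hone (fun j => ⟨hi, by fin_cases j; exact hTb i⟩)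
    simp only [Finset.univ_unique, Fin.default_eq_zero, Fin.isValue, Finset.sum_singleton] at h1
    have h2 : κ i ^ 2 ≤ s ^ 2 := h1.trans hhs
    by_contra hlt
    push Not at hlt
    nlinarith [mul_pos (by linarith : (0 : ℝ) < -s - κ i) (by linarith : (0 : ℝ) < s - κ i)]
  have h0 := hasSum_norm_inner_sq b y
  have h1 := hasSum_eigen_norm_sq b hsym hTb y
  have hle : ∀ i, -s * ‖⟪b i, y⟫_𝕜‖ ^ 2 ≤ κ i * ‖⟪b i, y⟫_𝕜‖ ^ 2 := fun i =>
    mul_le_mul_of_nonneg_right (hmin i) (sq_nonneg _)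
  exact hasSum_le hle (h0.mul_left (-s)) h1

/-- **The orthogonal projection is the best approximation and is a contraction.** For a subspace `K` with
orthogonal projection and `v ∈ K`: `‖x - P_K x‖ ≤ ‖x - v‖`, `‖P_K x‖ ≤ ‖x‖`, and `⟪x - P_K x, P_K x⟫ = 0`.
[folklore] -/
theorem norm_sub_starProjection_le_of_mem (K : Submodule 𝕜 H) [K.HasOrthogonalProjection] (x : H)
    {v : H} (hv : v ∈ K) :
    ‖x - K.starProjection x‖ ≤ ‖x - v‖ ∧ ‖K.starProjection x‖ ≤ ‖x‖ ∧
      ⟪x - K.starProjection x, K.starProjection x⟫_𝕜 = 0 := by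
  have horth : x - K.starProjection x ∈ Kᗮ := K.sub_starProjection_mem_orthogonal x
  have hPx : K.starProjection x ∈ K := K.starProjection_apply_mem x
  refine ⟨?_, K.norm_starProjection_apply_le x, ?_⟩
  · -- Pythagoras: `‖x - v‖² = ‖x - Px‖² + ‖Px - v‖²`
    have hmem : K.starProjection x - v ∈ K := K.sub_mem hPx hv
    have h0 : ⟪x - K.starProjection x, K.starProjection x - v⟫_𝕜 = 0 :=
      Submodule.inner_left_of_mem_orthogonal hmem horth
    have hdecomp : x - v = (x - K.starProjection x) + (K.starProjection x - v) := by abel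
    have hpy : ‖x - v‖ * ‖x - v‖ =
        ‖x - K.starProjection x‖ * ‖x - K.starProjection x‖ +
          ‖K.starProjection x - v‖ * ‖K.starProjection x - v‖ := by
      rw [hdecomp]
      exact norm_add_sq_eq_norm_sq_add_norm_sq_of_inner_eq_zero _ _ h0
    nlinarith [norm_nonneg (x - v), norm_nonneg (x - K.starProjection x),
      norm_nonneg (K.starProjection x - v)]
  · exact Submodule.inner_left_of_mem_orthogonal hPx horth

/-- **Compression to an ARBITRARY closed subspace (no invariance asked)** — the hard-wall case.  For a bounded `A` on a
Hilbert space `H` and a complete subspace `V`, the compression `T = P_V ∘ A ∘ ι_V : V → V` has the form of `A` on `V`: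
`⟪v, T w⟫ = ⟪v, A w⟫` for `v, w ∈ V`; it is self-adjoint if `A` is, compact if `A` is, and positive if `A` is.  (These are the
hypotheses of the min–max / eigen-sequence package `CompactPositiveMinMaxLevels` for the Dirichlet (hard-wall) compression
`1_S K 1_S` of a positive compact transfer operator, where `V = {f | f = 0 a.e. off S}` is NOT `K`-invariant.)
[cite: ReedSimonI1980, Thm. VI.16] [cite: Kato1966, §V.3.5] -/
theorem exists_compression_general [CompleteSpace H] (A : H →L[𝕜] H) (V : Submodule 𝕜 H) [CompleteSpace V] :
    ∃ T : V →L[𝕜] V, (∀ v w : V, ⟪v, T w⟫_𝕜 = ⟪(v : H), A w⟫_𝕜) ∧ (IsSelfAdjoint A → IsSelfAdjoint T) ∧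
      (IsCompactOperator A → IsCompactOperator T) ∧
      ((∀ x : H, 0 ≤ RCLike.re ⟪x, A x⟫_𝕜) → ∀ v : V, 0 ≤ RCLike.re ⟪v, T v⟫_𝕜) := by
  set T : V →L[𝕜] V := V.orthogonalProjectionOnto.comp (A.comp V.subtypeL) with hT
  have hin : ∀ v w : V, ⟪v, T w⟫_𝕜 = ⟪(v : H), A w⟫_𝕜 := fun v w => by
    change ⟪v, V.orthogonalProjectionOnto (A (w : H))⟫_𝕜 = _
    rw [Submodule.inner_orthogonalProjectionOnto_eq_of_mem_left]
  refine ⟨T, hin, fun hA => ?_, fun hAc => ?_, fun hpos v => ?_⟩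
  · rw [ContinuousLinearMap.isSelfAdjoint_iff_isSymmetric]
    intro v w
    change ⟪T v, w⟫_𝕜 = ⟪v, T w⟫_𝕜
    have h1 : ⟪T v, w⟫_𝕜 = ⟪A (v : H), (w : H)⟫_𝕜 := by
      rw [← inner_conj_symm, hin, inner_conj_symm]
    rw [h1, hin]
    exact (ContinuousLinearMap.isSelfAdjoint_iff_isSymmetric.1 hA) v w
  · have h1 : IsCompactOperator (A.comp V.subtypeL) := hAc.comp_clm V.subtypeL
    exact h1.clm_comp V.orthogonalProjectionOnto
  · rw [hin]
    exact hpos v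

end Literature.Analysis.OperatorTheory

end
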